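import Mathlib.NumberTheory.LSeries.Nonvanishing
import Literature.NumberTheory.LFunctions.SubnormalZetaGapsLOneLowerBound
import Literature.NumberTheory.LFunctions.Zhang2022.SkeletonSetting
import HarnessLib

/-!
# The Theorem-1 SHAPE `L(1,χ) > c₁(log D)^{−A}` split by PARITY of the real primitive character —
# odd half (imaginary quadratic fields) / even half (real quadratic fields) — and the CI-GAPS door
# landing on the ODD half (Conrey–Iwaniec 2002, Theorem 1.2)

Topic `Literature/NumberTheory/LFunctions`. DEFINITIONS + PROVED bookkeeping; nothing asserted.
Typed for cell ls-idea (desk ls-idea-plan g2, ★-DOORS LINE-READINESS PACKET v1 §4/§6 item 2,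
2026-08-28): the tree's leaf shape `Zhang2022.Skeleton.LOneLowerBound A` («there is an absolute
`c₁ > 0` with `c₁/(log D)^A < ‖L(1,χ)‖` for every real primitive `χ` mod `D ≥ 3`», the shape of
Theorem 1 of arXiv:2211.02515 with a general exponent) quantifies over ALL real primitive characters,
whereas Conrey–Iwaniec's Theorem 1.2 (the CI-GAPS door of record, `ciGaps_door_exists`) is printed for
ODD characters `χ = (−q/·)` only (imaginary quadratic `K = ℚ(√−q)`). The desk's «honest leaf gap»
therefore asks for the two PARITY HALVES of the leaf as named predicates — so that a CI-GAPS line can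
be registered against the odd half, or an even-character twin crux can be filed against the even
half — together with the definitional links: `LOneLowerBound A ↔ LOneLowerBoundOdd A ∧
LOneLowerBoundEven A`, monotonicity in `A`, and the CI-GAPS glue
`conreyIwaniec2002_theorem12 → (∃ c > 0, SubnormalGapsHypothesis c) → LOneLowerBoundOdd 90`
(the small conductors `D = 3, 4`, excluded by CI's `q > 4`, are absorbed into the constant by the
non-vanishing `L(1,χ) ≠ 0` and finiteness of the character groups). «The programme SEARCHES and
TYPES; no claim about Landau–Siegel zeros, Theorems 1–2 of arXiv:2211.02515 or a repaired Margin232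
until a kernel theorem says so»; typed ≠ proved; nothing here asserts (1.22) or any exceptional-zero
statement.

## References
* [Zhang2022LandauSiegel] Y. Zhang, arXiv:2211.02515v1, §1 Theorem 1 (the shape `L(1,χ) > c₁(log D)^{−2022}`
  for real primitive `χ`). [held]
* [ConreyIwaniec2002] J. B. Conrey, H. Iwaniec, *Spacing of zeros of Hecke L-functions and the class
  number problem*, Acta Arith. 103 (2002) 259–312, Theorem 1.2 (odd real characters, `q > 4`). [held]
-/

noncomputable section

namespace Literature.NumberTheory.LFunctions

/-- **The ODD half of the Theorem-1 shape**: there is an absolute `c₁ > 0` with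
`c₁/(log D)^A < ‖L(1,χ)‖` for every real primitive ODD character `χ` (`χ(−1) = −1`; imaginary
quadratic fields) to a modulus `D ≥ 3`. Same binders and strict inequality as
`Zhang2022.Skeleton.LOneLowerBound A`, plus `χ.Odd`. A PREDICATE in `A`; nothing asserted.
[cite: Zhang2022LandauSiegel, §1 Theorem 1 (shape, restricted to odd χ)] [cite: ConreyIwaniec2002, Theorem 1.2 (the odd real characters (−q/·))] -/
def LOneLowerBoundOdd (A : ℕ) : Prop :=
  ∃ c₁ : ℝ, 0 < c₁ ∧ ∀ (D : ℕ) [NeZero D] (χ : DirichletCharacter ℂ D),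
    3 ≤ D → χ.IsQuadratic → χ.IsPrimitive → χ.Odd → c₁ / Real.log D ^ A < ‖χ.LFunction 1‖

/-- **The EVEN half of the Theorem-1 shape**: there is an absolute `c₁ > 0` with
`c₁/(log D)^A < ‖L(1,χ)‖` for every real primitive EVEN character `χ` (`χ(−1) = 1`; real quadratic
fields) to a modulus `D ≥ 3`. The «even-character twin» the CI-GAPS door does not print. A PREDICATE
in `A`; nothing asserted. [cite: Zhang2022LandauSiegel, §1 Theorem 1 (shape, restricted to even χ)] -/
def LOneLowerBoundEven (A : ℕ) : Prop :=
  ∃ c₁ : ℝ, 0 < c₁ ∧ ∀ (D : ℕ) [NeZero D] (χ : DirichletCharacter ℂ D),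
    3 ≤ D → χ.IsQuadratic → χ.IsPrimitive → χ.Even → c₁ / Real.log D ^ A < ‖χ.LFunction 1‖

/-- The full shape implies its odd half (proved, definitional). [cite: Zhang2022LandauSiegel, §1 Theorem 1] -/
theorem lOneLowerBoundOdd_of_lOneLowerBound {A : ℕ} (h : Zhang2022.Skeleton.LOneLowerBound A) :
    LOneLowerBoundOdd A := by
  obtain ⟨c₁, hc₁, h⟩ := h
  exact ⟨c₁, hc₁, fun D _ χ hD hq hp _ ↦ h D χ hD hq hp⟩

/-- The full shape implies its even half (proved, definitional). [cite: Zhang2022LandauSiegel, §1 Theorem 1] -/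
theorem lOneLowerBoundEven_of_lOneLowerBound {A : ℕ} (h : Zhang2022.Skeleton.LOneLowerBound A) :
    LOneLowerBoundEven A := by
  obtain ⟨c₁, hc₁, h⟩ := h
  exact ⟨c₁, hc₁, fun D _ χ hD hq hp _ ↦ h D χ hD hq hp⟩

/-- The two halves reassemble the full shape (proved): every Dirichlet character into `ℂ` is even or
odd (`DirichletCharacter.even_or_odd`); take the smaller constant. [cite: Zhang2022LandauSiegel, §1 Theorem 1] -/
theorem lOneLowerBound_of_odd_of_even {A : ℕ} (ho : LOneLowerBoundOdd A) (he : LOneLowerBoundEven A) :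
    Zhang2022.Skeleton.LOneLowerBound A := by
  obtain ⟨c₁, hc₁, ho⟩ := ho
  obtain ⟨c₂, hc₂, he⟩ := he
  refine ⟨min c₁ c₂, lt_min hc₁ hc₂, fun D _ χ hD hq hp ↦ ?_⟩
  have hpow : 0 < Real.log (D : ℝ) ^ A := by
    have h3 : (3 : ℝ) ≤ D := by exact_mod_cast hD
    exact pow_pos (Real.log_pos (by linarith)) A
  rcases χ.even_or_odd with hev | hod
  · calc min c₁ c₂ / Real.log D ^ A ≤ c₂ / Real.log D ^ A :=
          div_le_div_of_nonneg_right (min_le_right _ _) hpow.le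
      _ < ‖χ.LFunction 1‖ := he D χ hD hq hp hev
  · calc min c₁ c₂ / Real.log D ^ A ≤ c₁ / Real.log D ^ A :=
          div_le_div_of_nonneg_right (min_le_left _ _) hpow.le
      _ < ‖χ.LFunction 1‖ := ho D χ hD hq hp hod

/-- **Leaf = odd half ∧ even half** (proved). The CI-GAPS door closes the odd conjunct only.
[cite: Zhang2022LandauSiegel, §1 Theorem 1] [cite: ConreyIwaniec2002, Theorem 1.2] -/
theorem lOneLowerBound_iff_odd_and_even {A : ℕ} :
    Zhang2022.Skeleton.LOneLowerBound A ↔ LOneLowerBoundOdd A ∧ LOneLowerBoundEven A :=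
  ⟨fun h ↦ ⟨lOneLowerBoundOdd_of_lOneLowerBound h, lOneLowerBoundEven_of_lOneLowerBound h⟩,
    fun h ↦ lOneLowerBound_of_odd_of_even h.1 h.2⟩

/-- Monotonicity of the odd half in the exponent (proved): `log D ≥ 1` for `D ≥ 3`.
[cite: Zhang2022LandauSiegel, §1 Theorem 1] -/
theorem LOneLowerBoundOdd.mono {A B : ℕ} (hAB : A ≤ B) (h : LOneLowerBoundOdd A) :
    LOneLowerBoundOdd B := by
  obtain ⟨c₁, hc₁, h⟩ := h
  refine ⟨c₁, hc₁, fun D _ χ hD hq hp ho ↦ lt_of_le_of_lt ?_ (h D χ hD hq hp ho)⟩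
  have h3 : (3 : ℝ) ≤ D := by exact_mod_cast hD
  have hlog : 1 ≤ Real.log (D : ℝ) := by
    rw [← Real.log_exp 1]
    exact Real.log_le_log (Real.exp_pos 1) (by linarith [Real.exp_one_lt_d9])
  exact div_le_div_of_nonneg_left hc₁.le (by positivity) (pow_le_pow_right₀ hlog hAB)

/-- Monotonicity of the even half in the exponent (proved). [cite: Zhang2022LandauSiegel, §1 Theorem 1] -/
theorem LOneLowerBoundEven.mono {A B : ℕ} (hAB : A ≤ B) (h : LOneLowerBoundEven A) :
    LOneLowerBoundEven B := by
  obtain ⟨c₁, hc₁, h⟩ := h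
  refine ⟨c₁, hc₁, fun D _ χ hD hq hp he ↦ lt_of_le_of_lt ?_ (h D χ hD hq hp he)⟩
  have h3 : (3 : ℝ) ≤ D := by exact_mod_cast hD
  have hlog : 1 ≤ Real.log (D : ℝ) := by
    rw [← Real.log_exp 1]
    exact Real.log_le_log (Real.exp_pos 1) (by linarith [Real.exp_one_lt_d9])
  exact div_le_div_of_nonneg_left hc₁.le (by positivity) (pow_le_pow_right₀ hlog hAB)

/-! ### The CI-GAPS door lands on the odd half (proved modulo the named fact Theorem 1.2) -/

/-- At ONE modulus `D ≥ 1` the values `‖L(1,χ)‖`, `χ ≠ 1`, have a uniform positive lower bound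
(finitely many characters; `L(1,χ) ≠ 0` for `χ ≠ 1`, Mathlib `LFunction_apply_one_ne_zero`).
[folklore] -/
private theorem exists_lOne_lower_at (D : ℕ) [NeZero D] :
    ∃ m : ℝ, 0 < m ∧ ∀ χ : DirichletCharacter ℂ D, χ ≠ 1 → m ≤ ‖χ.LFunction 1‖ := by
  classical
  haveI : Finite (DirichletCharacter ℂ D) := MulChar.finite
  let f : DirichletCharacter ℂ D → ℝ := fun χ ↦ if χ = 1 then 1 else ‖χ.LFunction 1‖
  have hfpos : ∀ χ, 0 < f χ := by
    intro χ
    by_cases hχ : χ = 1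
    · simp [f, hχ]
    · simp only [f, hχ, if_false]
      exact norm_pos_iff.mpr (DirichletCharacter.LFunction_apply_one_ne_zero hχ)
  obtain ⟨χ₀, hχ₀⟩ := Finite.exists_min f
  refine ⟨f χ₀, hfpos χ₀, fun χ hχ ↦ ?_⟩
  have := hχ₀ χ
  simp only [f, hχ, if_false] at this
  exact this

/-- Uniform positive lower bound for `‖L(1,χ)‖` over all nontrivial characters of modulus `D ≤ 4`
(the four finite character groups mod `1, 2, 3, 4`). [folklore] -/
private theorem exists_lOne_lower_le_four :
    ∃ m : ℝ, 0 < m ∧ ∀ (D : ℕ) [NeZero D] (χ : DirichletCharacter ℂ D), D ≤ 4 → χ ≠ 1 →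
      m ≤ ‖χ.LFunction 1‖ := by
  obtain ⟨m₁, hm₁, h₁⟩ := exists_lOne_lower_at 1
  obtain ⟨m₂, hm₂, h₂⟩ := exists_lOne_lower_at 2
  obtain ⟨m₃, hm₃, h₃⟩ := exists_lOne_lower_at 3
  obtain ⟨m₄, hm₄, h₄⟩ := exists_lOne_lower_at 4
  refine ⟨min (min m₁ m₂) (min m₃ m₄), by positivity, fun D _ χ hD hχ ↦ ?_⟩
  have hD0 : D ≠ 0 := NeZero.ne D
  interval_cases D
  · exact absurd rfl hD0
  · exact (h₁ χ hχ).trans' ((min_le_left _ _).trans (min_le_left _ _))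
  · exact (h₂ χ hχ).trans' ((min_le_left _ _).trans (min_le_right _ _))
  · exact (h₃ χ hχ).trans' ((min_le_right _ _).trans (min_le_left _ _))
  · exact (h₄ χ hχ).trans' ((min_le_right _ _).trans (min_le_right _ _))

/-- **The CI-GAPS door closes the ODD HALF of the leaf at exponent `90` (proved modulo the named
fact `conreyIwaniec2002_theorem12`):** if (1.22) holds with some implied constant `c > 0`
(`SubnormalGapsHypothesis c`), then `LOneLowerBoundOdd 90`. For `D > 4` this is
`ciGaps_door_exists` (with half its constant, to make the inequality strict); the conductors
`D = 3, 4` (odd real primitive characters `χ₋₃`, `χ₋₄` exist there) are absorbed into the constant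
by `L(1,χ) ≠ 0` and finiteness. The EVEN half is not touched. Nothing here asserts (1.22).
[cite: ConreyIwaniec2002, Theorem 1.2] -/
theorem lOneLowerBoundOdd_of_ciGaps (hCI : conreyIwaniec2002_theorem12)
    (hX : ∃ c : ℝ, 0 < c ∧ SubnormalGapsHypothesis c) : LOneLowerBoundOdd 90 := by
  obtain ⟨c', hc', h⟩ := ciGaps_door_exists hCI hX
  obtain ⟨m, hm, hsmall⟩ := exists_lOne_lower_le_four
  refine ⟨min (c' / 2) (m / 2), by positivity, fun D _ χ hD hq hp ho ↦ ?_⟩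
  have h3 : (3 : ℝ) ≤ D := by exact_mod_cast hD
  have hlog1 : 1 ≤ Real.log (D : ℝ) := by
    rw [← Real.log_exp 1]
    exact Real.log_le_log (Real.exp_pos 1) (by linarith [Real.exp_one_lt_d9])
  have hpow1 : 1 ≤ Real.log (D : ℝ) ^ 90 := one_le_pow₀ hlog1
  have hpow : 0 < Real.log (D : ℝ) ^ 90 := by positivity
  by_cases h4 : 4 < D
  · have hci := h D h4 χ hp hq ho
    have hrpow : Real.log (D : ℝ) ^ (-(90 : ℝ)) = (Real.log (D : ℝ) ^ 90)⁻¹ := by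
      rw [Real.rpow_neg (by linarith), ← Real.rpow_natCast]
      norm_num
    rw [hrpow, ← div_eq_mul_inv] at hci
    calc min (c' / 2) (m / 2) / Real.log D ^ 90 ≤ (c' / 2) / Real.log D ^ 90 :=
          div_le_div_of_nonneg_right (min_le_left _ _) hpow.le
      _ < c' / Real.log D ^ 90 := by
          apply div_lt_div_of_pos_right _ hpow
          linarith
      _ ≤ ‖χ.LFunction 1‖ := hci
  · push Not at h4
    have hχ1 : χ ≠ 1 := by
      rintro rfl
      have hc : DirichletCharacter.conductor (1 : DirichletCharacter ℂ D) = D := hp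
      rw [DirichletCharacter.conductor_one] at hc
      omega
    have hmle := hsmall D χ h4 hχ1
    calc min (c' / 2) (m / 2) / Real.log D ^ 90 ≤ min (c' / 2) (m / 2) :=
          div_le_self (by positivity) hpow1
      _ ≤ m / 2 := min_le_right _ _
      _ < m := by linarith
      _ ≤ ‖χ.LFunction 1‖ := hmle

end Literature.NumberTheory.LFunctions
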